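import Summits.BirchSwinnertonDyer.BirchSwinnertonDyer.Theorems.SignedLowerHalvesSmallImageLowerHalfBothSignsRttD2SeqJ3Localization
import Summits.BirchSwinnertonDyer.BirchSwinnertonDyer.Theorems.SignedLowerHalvesSmallImageLowerHalfBothSignsRttD2SeqJ3Transitions
import HarnessLib

/-!
# Route `SignedLowerHalves`, crux L `SmallImageLowerHalfBothSigns` (stmt-BirchSwinnertonDyer-23599), line `rtt_w3` v14 → v15 — E2, row J3
# (Galois side, part β₃c): THE INHABITANT OF THE FINITE-LEVEL SOCKET `LayerPairing` — `⟨y, ℓ⟩_{n,k} = inv_{U_{n,v}}(loc_{n,v} y ∪ ℓ)/p^k`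

WIDTH seat `bsd-line-slh-p3-w3` g22 under LEAD `cruxlead-stmt-BirchSwinnertonDyer-23599` g11 (cell `bsd-ssimc`); helper `--supports stmt-BirchSwinnertonDyer-23599`.
DEFINITIONS WITH BODIES + THEOREMS; no named fact, no instance, no `sorry`. HONEST FRAMING: assembles the local Tate pairings of the layers (β₃a: p786363, p787141) with the
localisation of honda's layer groups (β₃b) into an inhabitant `layerPairingOf … : LayerPairing S M γ_v κ γ_B θ′ P` (p784142) for ANY discrete `p`-primary `Γ_{K_v}`-module `M` with
open stabilisers and `𝒪`-scalars, GIVEN a family of coefficient pairings `P_k : X_k × M[p^k] → μ_{p^k}` compatible with reduction/inclusion and balanced for the `𝒪`-scalars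
(`hPred`, `hPsc` — for `M = (F/𝒪)(θ)`, `X_k = 𝒪 ⊗ μ_{p^k} ⊗ θ′`, `θθ′ = 1`, these are the trace pairings; their construction is the remaining coefficient-level input), at a place `v`
NON-SPLIT in `K_∞` with `K_∞/K` unramified outside `P` and `γ_B · res_v(γ_v) ∈ ker κ` (RULING (F2)). Composed with `exists_junction_exact_of_layerPairing` (p784993) this leaves, for
J3 = `j₀ : B′ →ₗ[Λ_𝒪] DQ.X` + `Exact j₀ gX`: the strict sets `Str` (β₆), finiteness `hfin` (β₇), local reciprocity `hrecL` (β₄) and finite solvability `hsolL` (β₅). E2, crux L, crux M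
and BSD remain OPEN and are proved for NO curve.

* §1 instance plumbing for the local tower (`IsClosed`, `Fintype` quotients — named, so every use elaborates to the same term), `torsIncl_refl/_trans`.
* §2 `locPairNK n k := pairLoc n k ∘ loc_{n,k}` : `cycLayerCohO S κ θ′ P n k 1 →+ Hom(H¹(U_{n,v}, M[p^k]), ℚ/ℤ)`; its four laws `locPairNK_cycCoresLE` (all `n ≤ n′`, induction from
  the one-step projection formula + Mackey), `locPairNK_cycRedLE` (all `k ≤ k′`), `locPairNK_conj`, `locPairNK_scalar`.
* §3 ★★★ `layerPairingOf` — the inhabitant (`L n k := H¹(U_{n,v}, M[p^k])`, `toH1/resLE/inclLE/conjL/scalarL` from β₂ p785597, exhaustion + kernel control from β₂, pairings §2).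
References: [NeukirchSchmidtWingberg2008] I §5 Prop. 1.5.3–1.5.4, (7.2.6); [Kato2004Asterisque] §17.13; [Rubin2000] §4.2, App. B.2; [PerrinRiou1987] §4; [Kim2009] Prop. 3.9.
-/

set_option autoImplicit false
set_option linter.dupNamespace false -- D-0017: single-problem summit, the namespace repeats the problem name by design
noncomputable section

open scoped Classical
open NumberField IsDedekindDomain Field CategoryTheory Function

namespace Summit.BirchSwinnertonDyer.BirchSwinnertonDyer.Theorems.SmallImageRttD2Seq

open Literature.NumberTheory.EllipticCurves Literature.NumberTheory.GaloisRepresentations Literature.NumberTheory.GaloisCohomology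
  Literature.NumberTheory.ComplexMultiplication.EllipticUnits.JohnsonLeungKings2011
  Summit.BirchSwinnertonDyer.BirchSwinnertonDyer.Theorems.SmallImageRttD2J1

section Assembly

variable {K : Type} [Field K] [NumberField K] {p : ℕ} [Fact p.Prime] (S : Set (PadicAlgCl p)) (κ : ZpExtension K p)
  (θ' : absoluteGaloisGroup K →ₜ* (padicCoeffIntegers S)ˣ) (P : Set (HeightOneSpectrum (𝓞 K))) (v : HeightOneSpectrum (𝓞 K))
  (M : Type) [AddCommGroup M] [TopologicalSpace M] [DiscreteTopology M] [DistribMulAction (absoluteGaloisGroup (v.adicCompletion K)) M]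
  (hstab : ∀ m : M, IsOpen (MulAction.stabilizer (absoluteGaloisGroup (v.adicCompletion K)) m : Set (absoluteGaloisGroup (v.adicCompletion K))))

/-! ## §1. Instance plumbing for the local tower -/

/-- `U_{n,v}` is closed. [folklore] -/
theorem isClosed_localLayer (n : ℕ) :
    IsClosed (localSubgroupOfEmb (κ.layerSubgroup n) (closureEmb (K := K) (v.adicCompletion K)) : Set (absoluteGaloisGroup (v.adicCompletion K))) :=
  Subgroup.isClosed_of_isOpen _ (isOpen_localSubgroupOfEmb_layerSubgroup κ v n)

/-- `Γ_{K_v}/U_{n,v}` is finite (a `Fintype`, named so that all uses agree). [folklore] -/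
@[reducible] def fintypeQuotLocalLayer (n : ℕ) :
    Fintype (absoluteGaloisGroup (v.adicCompletion K) ⧸ localSubgroupOfEmb (κ.layerSubgroup n) (closureEmb (K := K) (v.adicCompletion K))) :=
  haveI : CompactSpace (absoluteGaloisGroup (v.adicCompletion K)) := absoluteGaloisGroup_compactSpace _
  haveI := Subgroup.quotient_finite_of_isOpen _ (isOpen_localSubgroupOfEmb_layerSubgroup κ v n)
  Fintype.ofFinite _

/-- `U_{n,v}/U_{n+1,v}` is finite (a `Fintype`, named so that all uses agree). [folklore] -/
@[reducible] def fintypeRelQuotLocalLayer (n : ℕ) :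
    Fintype (↥(localSubgroupOfEmb (κ.layerSubgroup n) (closureEmb (K := K) (v.adicCompletion K))) ⧸
      (localSubgroupOfEmb (κ.layerSubgroup (n + 1)) (closureEmb (K := K) (v.adicCompletion K))).subgroupOf
        (localSubgroupOfEmb (κ.layerSubgroup n) (closureEmb (K := K) (v.adicCompletion K)))) :=
  haveI : CompactSpace (absoluteGaloisGroup (v.adicCompletion K)) := absoluteGaloisGroup_compactSpace _
  haveI : (localSubgroupOfEmb (κ.layerSubgroup (n + 1)) (closureEmb (K := K) (v.adicCompletion K))).FiniteIndex :=
    finiteIndex_of_isOpen_of_compactSpace _ (isOpen_localSubgroupOfEmb_layerSubgroup κ v (n + 1))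
  Fintype.ofFinite _

omit [Fact p.Prime] in
/-- `torsIncl` along `k ≤ k` is the identity. [folklore] -/
theorem torsIncl_refl (U : Subgroup (absoluteGaloisGroup (v.adicCompletion K))) (k : ℕ) (ℓ : subgroupH1 U ↥(torsionPow M p k)) :
    torsIncl M p U (le_refl k) ℓ = ℓ := by
  have h : torsIncl M p U (le_refl k) = AddMonoidHom.id _ := by
    rw [torsIncl, ← resH1Hom_id (G := ↥U) (M := ↥(torsionPow M p k))]
    exact resH1Hom_congr rfl (by ext; rfl) _ _
  rw [h]; rfl

omit [Fact p.Prime] in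
/-- `torsIncl` is transitive. [folklore] -/
theorem torsIncl_trans (U : Subgroup (absoluteGaloisGroup (v.adicCompletion K))) {k k' k'' : ℕ} (h : k ≤ k') (h' : k' ≤ k'') (ℓ : subgroupH1 U ↥(torsionPow M p k)) :
    torsIncl M p U h' (torsIncl M p U h ℓ) = torsIncl M p U (h.trans h') ℓ := by
  rw [← AddMonoidHom.comp_apply, torsIncl, torsIncl, torsIncl, resH1Hom_comp]
  exact DFunLike.congr_fun (resH1Hom_congr rfl (by ext; rfl) _ _) ℓ

/-! ## §2. The pairings `⟨y, ℓ⟩_{n,k} = inv_{U_{n,v}}(loc y ∪ ℓ)/p^k` and their four laws -/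

variable (Pk : ∀ k : ℕ, ContPairing (locCoeffRep S θ' P v k).toTopRep (torsRep M hstab p k).toTopRep (muAt K (p ^ k) v).toTopRep)

/-- ★ **`⟨y, ℓ⟩_{n,k} := pairLoc_{n,k}(loc_{n,v} y)(ℓ) = inv_{U_{n,v}}(loc_{n,v} y ∪_{P_k} ℓ)/p^k`** on `cycLayerCohO S κ θ′ P n k 1 × H¹(U_{n,v}, M[p^k])`.
[cite: NeukirchSchmidtWingberg2008, I §5 Prop. 1.5.3 (iv), (7.2.6)] [cite: Kato2004Asterisque, §17.13] -/
def locPairNK (n k : ℕ) :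
    cycLayerCohO S κ θ' P n k 1 →+
      (subgroupH1 (localSubgroupOfEmb (κ.layerSubgroup n) (closureEmb (K := K) (v.adicCompletion K))) ↥(torsionPow M p k) →+ AddCircle (1 : ℚ)) :=
  haveI := isClosed_localLayer κ v
  letI := fintypeQuotLocalLayer κ v
  (pairLoc κ v M hstab (locCoeffRep S θ' P v) Pk n k).comp (locNK S κ θ' P v n k)

/-- Unfolding `locPairNK`. [folklore] -/
theorem locPairNK_apply (n k : ℕ) (y : cycLayerCohO S κ θ' P n k 1)
    (ℓ : subgroupH1 (localSubgroupOfEmb (κ.layerSubgroup n) (closureEmb (K := K) (v.adicCompletion K))) ↥(torsionPow M p k)) :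
    locPairNK S κ θ' P v M hstab Pk n k y ℓ =
      haveI := isClosed_localLayer κ v
      letI := fintypeQuotLocalLayer κ v
      pairLoc κ v M hstab (locCoeffRep S θ' P v) Pk n k (locNK S κ θ' P v n k y) ℓ :=
  rfl

/-- ★ **cores ⊣ res for all `n ≤ n′`**: `⟨cycCoresLE y, ℓ⟩_{n,k} = ⟨y, res ℓ⟩_{n′,k}` (induction on `n′` from the projection formula `pairLoc_coresLe` and the Mackey formula `locNK_cycLayerCoresO`).
[cite: NeukirchSchmidtWingberg2008, I §5 Prop. 1.5.3 (iv), Prop. 1.5.4] -/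
theorem locPairNK_cycCoresLE (hNP : ∀ n, ramificationSubgroup K P ≤ κ.layerSubgroup n) (hv : AcSigned.IsNonsplitIn κ v) {n n' : ℕ} (h : n ≤ n') (k : ℕ)
    (y : cycLayerCohO S κ θ' P n' k 1) (ℓ : subgroupH1 (localSubgroupOfEmb (κ.layerSubgroup n) (closureEmb (K := K) (v.adicCompletion K))) ↥(torsionPow M p k)) :
    locPairNK S κ θ' P v M hstab Pk n k (cycCoresLE S κ θ' P 1 h k y) ℓ =
      locPairNK S κ θ' P v M hstab Pk n' k y (resOfLe ↥(torsionPow M p k) (localSubgroupOfEmb_layerSubgroup_antitone κ v h) ℓ) := by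
  induction n', h using Nat.le_induction with
  | base =>
    rw [cycCoresLE_refl, show resOfLe ↥(torsionPow M p k) (localSubgroupOfEmb_layerSubgroup_antitone κ v (le_refl n)) = AddMonoidHom.id _ from
      resOfLe_refl_holds _, AddMonoidHom.id_apply]
  | succ n' h ih =>
    haveI := isClosed_localLayer κ v
    letI := fintypeQuotLocalLayer κ v
    letI := fintypeRelQuotLocalLayer κ v
    rw [← cycCoresLE_trans S κ θ' P 1 h (Nat.le_succ n'), cycCoresLE_succ, ih, locPairNK_apply, locPairNK_apply, locNK_cycLayerCoresO S κ θ' P v hNP hv,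
      pairLoc_coresLe, resLe_torsRep_eq_resOfLe, ← AddMonoidHom.comp_apply, resOfLe_comp_holds]

/-- ★ **red ⊣ incl for all `k ≤ k′`**: `⟨cycRedLE y, ℓ⟩_{n,k} = ⟨y, incl ℓ⟩_{n,k′}`, given the level compatibility of the coefficient pairings (induction on `k′` from `pairLoc_red_incl`
and `locNK_cycLayerRedO`). [cite: NeukirchSchmidtWingberg2008, I §5 Prop. 1.5.3, (7.1.4)] [cite: SerreLocalFields1979, XIII §3 Cor. 3] -/
theorem locPairNK_cycRedLE
    (hPred : ∀ (k : ℕ) (x : ↥(Representation.invariants ((muTwistO S θ' (k + 1)).toRepresentation.comp (ramificationSubgroup K P).subtype))) (m : ↥(torsionPow M p k)),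
      (Pk (k + 1)).toLin x (AddSubgroup.inclusion (torsionPow_mono (M := M) (p := p) (Nat.le_succ k)) m) =
        muInclusion K (pow_dvd_pow p (Nat.le_succ k)) ((Pk k).toLin (coeffMapO S P θ' (oMuRed S k) (oMuRed_muTwistO S θ' k) x) m))
    (n : ℕ) {k k' : ℕ} (h : k ≤ k') (y : cycLayerCohO S κ θ' P n k' 1)
    (ℓ : subgroupH1 (localSubgroupOfEmb (κ.layerSubgroup n) (closureEmb (K := K) (v.adicCompletion K))) ↥(torsionPow M p k)) :
    locPairNK S κ θ' P v M hstab Pk n k (cycRedLE S κ θ' P 1 n h y) ℓ = locPairNK S κ θ' P v M hstab Pk n k' y (torsIncl M p _ h ℓ) := by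
  induction k', h using Nat.le_induction with
  | base => rw [cycRedLE_refl, torsIncl_refl]
  | succ k' h ih =>
    haveI := isClosed_localLayer κ v
    letI := fintypeQuotLocalLayer κ v
    haveI : CompactSpace (absoluteGaloisGroup (v.adicCompletion K)) := absoluteGaloisGroup_compactSpace _
    rw [← cycRedLE_trans S κ θ' P 1 n h (Nat.le_succ k'), cycRedLE_succ, ih, locPairNK_apply, locPairNK_apply, locNK_cycLayerRedO,
      pairLoc_red_incl κ v M hstab (locCoeffRep S θ' P v) Pk n (Nat.le_succ k') (coeffMapO S P θ' (oMuRed S k') (oMuRed_muTwistO S θ' k')).toAddMonoidHom _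
        (fun x m ↦ hPred k' x m),
      map_resHomOfEquivariant_inclusion_eq_torsIncl v M _ (Nat.le_succ k') (torsIncl M p _ h ℓ), torsIncl_trans]

/-- ★ **`conj_{γ_B} ⊣ conj_{γ_v}`** when `γ_B · res_v(γ_v) ∈ ker κ`: `⟨γ_B·y, ℓ⟩ = ⟨y, γ_v·ℓ⟩` (`locNK_cycLayerConjO` + Galois invariance `pairLoc_conjMap_inv`).
[cite: NeukirchSchmidtWingberg2008, I §5 Prop. 1.5.3 (iii)] [cite: Kato2004Asterisque, §17.13] -/
theorem locPairNK_conj (γB : absoluteGaloisGroup K) (γv : absoluteGaloisGroup (v.adicCompletion K))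
    (hγ : γB * resGalOfEmb (closureEmb (K := K) (v.adicCompletion K)) γv ∈ κ.kerSubgroup) (n k : ℕ) (y : cycLayerCohO S κ θ' P n k 1)
    (ℓ : subgroupH1 (localSubgroupOfEmb (κ.layerSubgroup n) (closureEmb (K := K) (v.adicCompletion K))) ↥(torsionPow M p k)) :
    haveI := normal_localSubgroupOfEmb_layerSubgroup κ v n
    locPairNK S κ θ' P v M hstab Pk n k (cycLayerConjO S κ θ' P n k 1 γB y) ℓ = locPairNK S κ θ' P v M hstab Pk n k y (conjH1 _ ↥(torsionPow M p k) γv ℓ) := by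
  haveI := normal_localSubgroupOfEmb_layerSubgroup κ v n
  rw [locPairNK_apply, locPairNK_apply, locNK_cycLayerConjO S κ θ' P v n k γB γv hγ, pairLoc_conjMap_inv, conjMap_torsRep_eq_conjH1]

variable [Module (padicCoeffIntegers S) M] [SMulCommClass (absoluteGaloisGroup (v.adicCompletion K)) (padicCoeffIntegers S) M]

/-- ★ **`H¹(a ⊗ id) ⊣ a`** for the `𝒪`-scalars, given the balance `P_k((a ⊗ id) x, m) = P_k(x, a·m)` (`locNK_cycLayerScalarO` + `pairLoc_coeffMapH1`).
[cite: NeukirchSchmidtWingberg2008, I §5 Prop. 1.5.3] [cite: JohnsonLeungKings2011, §4.1 Def. 4.1] -/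
theorem locPairNK_scalar
    (hPsc : ∀ (k : ℕ) (a : padicCoeffIntegers S) (x : ↥(Representation.invariants ((muTwistO S θ' k).toRepresentation.comp (ramificationSubgroup K P).subtype)))
      (m : ↥(torsionPow M p k)), (Pk k).toLin (coeffMapO S P θ' (oMuScalar S (p ^ k) a) (oMuScalar_muTwistO S θ' k a) x) m = (Pk k).toLin x (a • m))
    (n k : ℕ) (a : padicCoeffIntegers S) (y : cycLayerCohO S κ θ' P n k 1)
    (ℓ : subgroupH1 (localSubgroupOfEmb (κ.layerSubgroup n) (closureEmb (K := K) (v.adicCompletion K))) ↥(torsionPow M p k)) :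
    locPairNK S κ θ' P v M hstab Pk n k (cycLayerScalarO S κ θ' P n k 1 a y) ℓ = locPairNK S κ θ' P v M hstab Pk n k y (torsScalar M p _ k a ℓ) := by
  haveI := isClosed_localLayer κ v
  letI := fintypeQuotLocalLayer κ v
  haveI : CompactSpace (absoluteGaloisGroup (v.adicCompletion K)) := absoluteGaloisGroup_compactSpace _
  have hc : ∀ (g : absoluteGaloisGroup (v.adicCompletion K)) (x : ↥(Representation.invariants ((muTwistO S θ' k).toRepresentation.comp (ramificationSubgroup K P).subtype))),
      (coeffMapO S P θ' (oMuScalar S (p ^ k) a) (oMuScalar_muTwistO S θ' k a)).toAddMonoidHom (locCoeffRep S θ' P v k g x) =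
        locCoeffRep S θ' P v k g ((coeffMapO S P θ' (oMuScalar S (p ^ k) a) (oMuScalar_muTwistO S θ' k a)).toAddMonoidHom x) :=
    fun g x ↦ congrArg (fun φ : _ →L[ℤ] _ ↦ φ x) ((coeffMapHomO S P θ' (oMuScalar S (p ^ k) a) (oMuScalar_muTwistO S θ' k a)).hom.isIntertwining' (locGS P v g))
  have hbridge : redMapH1 v (locCoeffRep S θ' P v) (localSubgroupOfEmb (κ.layerSubgroup n) (closureEmb (K := K) (v.adicCompletion K)))
      (coeffMapO S P θ' (oMuScalar S (p ^ k) a) (oMuScalar_muTwistO S θ' k a)).toAddMonoidHom hc =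
      coeffMapH1 v (locCoeffRep S θ' P v) _ k (coeffMapO S P θ' (oMuScalar S (p ^ k) a) (oMuScalar_muTwistO S θ' k a)).toAddMonoidHom hc := rfl
  rw [locPairNK_apply, locPairNK_apply, locNK_cycLayerScalarO, hbridge,
    pairLoc_coeffMapH1 κ v M hstab (locCoeffRep S θ' P v) Pk n k _ hc a (fun x m ↦ hPsc k a x m), map_resHomOfEquivariant_eq_torsScalar]

/-! ## §3. The inhabitant -/

/-- ★★★ **THE INHABITANT OF THE FINITE-LEVEL SOCKET `LayerPairing`** (p784142) for a discrete `p`-primary `Γ_{K_v}`-module `M` with open stabilisers and `𝒪`-scalars: transition maps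
`cycCoresLE`/`cycRedLE` (β₁), local carriers `L_{n,k} = H¹(U_{n,v}, M[p^k])` with `toH1/resLE/inclLE/conjL/scalarL`, exhaustion and kernel control (β₂), pairings
`⟨y, ℓ⟩_{n,k} = inv_{U_{n,v}}(loc_{n,v} y ∪_{P_k} ℓ)/p^k` (β₃a/b) — GIVEN compatible balanced coefficient pairings `P_k`, `K_∞/K` unramified outside `P`, `v` non-split in `K_∞`, and
`γ_B · res_v(γ_v) ∈ ker κ`. [cite: NeukirchSchmidtWingberg2008, I §5 Prop. 1.5.3–1.5.4, (7.2.6)] [cite: Kato2004Asterisque, §17.13] [cite: Rubin2000, §4.2, App. B.2] -/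
def layerPairingOf (hM : ∀ m : M, ∃ k : ℕ, p ^ k • m = 0) (γB : absoluteGaloisGroup K) (γv : absoluteGaloisGroup (v.adicCompletion K))
    (hγ : γB * resGalOfEmb (closureEmb (K := K) (v.adicCompletion K)) γv ∈ κ.kerSubgroup)
    (hNP : ∀ n, ramificationSubgroup K P ≤ κ.layerSubgroup n) (hv : AcSigned.IsNonsplitIn κ v)
    (hPred : ∀ (k : ℕ) (x : ↥(Representation.invariants ((muTwistO S θ' (k + 1)).toRepresentation.comp (ramificationSubgroup K P).subtype))) (m : ↥(torsionPow M p k)),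
      (Pk (k + 1)).toLin x (AddSubgroup.inclusion (torsionPow_mono (M := M) (p := p) (Nat.le_succ k)) m) =
        muInclusion K (pow_dvd_pow p (Nat.le_succ k)) ((Pk k).toLin (coeffMapO S P θ' (oMuRed S k) (oMuRed_muTwistO S θ' k) x) m))
    (hPsc : ∀ (k : ℕ) (a : padicCoeffIntegers S) (x : ↥(Representation.invariants ((muTwistO S θ' k).toRepresentation.comp (ramificationSubgroup K P).subtype)))
      (m : ↥(torsionPow M p k)), (Pk k).toLin (coeffMapO S P θ' (oMuScalar S (p ^ k) a) (oMuScalar_muTwistO S θ' k a) x) m = (Pk k).toLin x (a • m)) :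
    LayerPairing S M γv κ γB θ' P where
  coresLE h k := cycCoresLE S κ θ' P 1 h k
  redLE n _ _ h := cycRedLE S κ θ' P 1 n h
  coresLE_refl n k y := cycCoresLE_refl S κ θ' P 1 n k y
  coresLE_trans h h' k y := cycCoresLE_trans S κ θ' P 1 h h' k y
  coresLE_succ n k y := cycCoresLE_succ S κ θ' P 1 n k y
  redLE_refl n k y := cycRedLE_refl S κ θ' P 1 n k y
  redLE_trans n _ _ _ h h' y := cycRedLE_trans S κ θ' P 1 n h h' y
  redLE_succ n k y := cycRedLE_succ S κ θ' P 1 n k y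
  coresLE_redLE h _ _ h' y := cycCoresLE_cycRedLE S κ θ' P 1 h h' y
  L n k := subgroupH1 (localSubgroupOfEmb (κ.layerSubgroup n) (closureEmb (K := K) (v.adicCompletion K))) ↥(torsionPow M p k)
  toH1 n k := torsToH1 M p _ k
  resLE h k := resOfLe ↥(torsionPow M p k) (localSubgroupOfEmb_layerSubgroup_antitone κ v h)
  inclLE n _ _ h := torsIncl M p _ h
  toH1_resLE h k ℓ := torsToH1_resOfLe M p (localSubgroupOfEmb_layerSubgroup_antitone κ v h) k ℓ
  toH1_inclLE n _ _ h ℓ := torsToH1_torsIncl M p _ h ℓ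
  conjL n k := haveI := normal_localSubgroupOfEmb_layerSubgroup κ v n; conjH1 _ ↥(torsionPow M p k) γv
  toH1_conjL n k ℓ := by
    haveI := normal_localSubgroupOfEmb_layerSubgroup κ v n
    exact torsToH1_conjH1 M p _ γv k ℓ
  scalarL n k a := torsScalar M p _ k a
  toH1_scalarL n k a ℓ := torsToH1_torsScalar M p _ k a ℓ
  exhaust n c := by
    haveI : CompactSpace (absoluteGaloisGroup (v.adicCompletion K)) := absoluteGaloisGroup_compactSpace _
    haveI : CompactSpace ↥(localSubgroupOfEmb (κ.layerSubgroup n) (closureEmb (K := K) (v.adicCompletion K))) :=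
      isCompact_iff_compactSpace.mp (isClosed_localLayer κ v n).isCompact
    exact exists_torsToH1_eq _ hM c
  ker_toH1 n k ℓ hℓ := exists_torsIncl_eq_zero_of_torsToH1_eq_zero _ hM k ℓ hℓ
  pairNK n k := locPairNK S κ θ' P v M hstab Pk n k
  pairNK_coresLE h k y ℓ := locPairNK_cycCoresLE S κ θ' P v M hstab Pk hNP hv h k y ℓ
  pairNK_redLE n _ _ h y ℓ := locPairNK_cycRedLE S κ θ' P v M hstab Pk hPred n h y ℓ
  pairNK_conj n k y ℓ := locPairNK_conj S κ θ' P v M hstab Pk γB γv hγ n k y ℓ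
  pairNK_scalar n k a y ℓ := locPairNK_scalar S κ θ' P v M hstab Pk hPsc n k a y ℓ

/-- The pairing of the inhabitant is `locPairNK`. [folklore] -/
theorem layerPairingOf_pairNK (hM : ∀ m : M, ∃ k : ℕ, p ^ k • m = 0) (γB : absoluteGaloisGroup K) (γv : absoluteGaloisGroup (v.adicCompletion K))
    (hγ : γB * resGalOfEmb (closureEmb (K := K) (v.adicCompletion K)) γv ∈ κ.kerSubgroup)
    (hNP : ∀ n, ramificationSubgroup K P ≤ κ.layerSubgroup n) (hv : AcSigned.IsNonsplitIn κ v)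
    (hPred : ∀ (k : ℕ) (x : ↥(Representation.invariants ((muTwistO S θ' (k + 1)).toRepresentation.comp (ramificationSubgroup K P).subtype))) (m : ↥(torsionPow M p k)),
      (Pk (k + 1)).toLin x (AddSubgroup.inclusion (torsionPow_mono (M := M) (p := p) (Nat.le_succ k)) m) =
        muInclusion K (pow_dvd_pow p (Nat.le_succ k)) ((Pk k).toLin (coeffMapO S P θ' (oMuRed S k) (oMuRed_muTwistO S θ' k) x) m))
    (hPsc : ∀ (k : ℕ) (a : padicCoeffIntegers S) (x : ↥(Representation.invariants ((muTwistO S θ' k).toRepresentation.comp (ramificationSubgroup K P).subtype)))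
      (m : ↥(torsionPow M p k)), (Pk k).toLin (coeffMapO S P θ' (oMuScalar S (p ^ k) a) (oMuScalar_muTwistO S θ' k a) x) m = (Pk k).toLin x (a • m))
    (n k : ℕ) :
    (layerPairingOf S κ θ' P v M hstab Pk hM γB γv hγ hNP hv hPred hPsc).pairNK n k = locPairNK S κ θ' P v M hstab Pk n k :=
  rfl

/-- The local carriers of the inhabitant are `H¹(U_{n,v}, M[p^k])` with `toH1 = torsToH1`. [folklore] -/
theorem layerPairingOf_toH1 (hM : ∀ m : M, ∃ k : ℕ, p ^ k • m = 0) (γB : absoluteGaloisGroup K) (γv : absoluteGaloisGroup (v.adicCompletion K))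
    (hγ : γB * resGalOfEmb (closureEmb (K := K) (v.adicCompletion K)) γv ∈ κ.kerSubgroup)
    (hNP : ∀ n, ramificationSubgroup K P ≤ κ.layerSubgroup n) (hv : AcSigned.IsNonsplitIn κ v)
    (hPred : ∀ (k : ℕ) (x : ↥(Representation.invariants ((muTwistO S θ' (k + 1)).toRepresentation.comp (ramificationSubgroup K P).subtype))) (m : ↥(torsionPow M p k)),
      (Pk (k + 1)).toLin x (AddSubgroup.inclusion (torsionPow_mono (M := M) (p := p) (Nat.le_succ k)) m) =
        muInclusion K (pow_dvd_pow p (Nat.le_succ k)) ((Pk k).toLin (coeffMapO S P θ' (oMuRed S k) (oMuRed_muTwistO S θ' k) x) m))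
    (hPsc : ∀ (k : ℕ) (a : padicCoeffIntegers S) (x : ↥(Representation.invariants ((muTwistO S θ' k).toRepresentation.comp (ramificationSubgroup K P).subtype)))
      (m : ↥(torsionPow M p k)), (Pk k).toLin (coeffMapO S P θ' (oMuScalar S (p ^ k) a) (oMuScalar_muTwistO S θ' k a) x) m = (Pk k).toLin x (a • m))
    (n k : ℕ) :
    (layerPairingOf S κ θ' P v M hstab Pk hM γB γv hγ hNP hv hPred hPsc).toH1 n k =
      torsToH1 M p (localSubgroupOfEmb (κ.layerSubgroup n) (closureEmb (K := K) (v.adicCompletion K))) k :=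
  rfl

end Assembly

end Summit.BirchSwinnertonDyer.BirchSwinnertonDyer.Theorems.SmallImageRttD2Seq

end
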